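import Summits.Ventures.LatticeQCDFlow.Scoring.WilsonFlowRK3Convergence
import HarnessLib

/-!
# A RATE for the engine's RK3 integrator: the one-step error is `O(ε²)` uniformly, so after `m` steps at fixed flow time the error is `O(1/m)`, uniformly in the configuration

HONEST FRAMING: exact (Metropolis-corrected) sampling algorithms for lattice gauge theory;
figures of merit are autocorrelation/cost numbers at stated couplings and volumes; no
continuum-physics claim.

Venture `LatticeQCDFlow` (cell pub-lqcd), sub-topic `Scoring`; FANOUT row 16 (`su2-base`).  Fourth file of the
RK3-CONVERGENCE packet (`OneStepMethodConvergence` — the abstract Lax theorem incl. the order-`p` bound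
`oneStep_dist_iterate_le_of_order`; `WilsonFlowRK3LocalError` — the ambient scheme `rk3Amb`, its joint
smoothness `contDiff_rk3Amb`, the step-size derivative `rk3AmbDeriv`, the local error `rk3LocalErr` and its
derivative `rk3LocalErrDeriv`; `WilsonFlowRK3Convergence` — `dist_coeConfig`, Grönwall `wilsonFlow_dist_le`,
qualitative convergence).  NEW WORK of the cell (placement rule) over the Literature Wilson flow
(`QuantumFieldTheory/WilsonFlow`: `contDiff_vfAmb`, `hasDerivAt_coeConfig_of_isWilsonFlowLine`).  Nothing is
cited as a fact; no number (the constants are existential).  Printed counterpart, NAMED ONLY: Lüscher, JHEP 08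
(2010) 071, App. C states the scheme is THIRD order; here FIRST order is proved (local `O(ε²)`, global `O(ε)`),
which is what two derivatives of smoothness give without the Lie-series order conditions.

## What is here (every `d`, `n`, `L ≥ 1`)

* §1 the SECOND step-size derivative of the ambient scheme, `rk3AmbDeriv2 = ∂_ε rk3AmbDeriv` (from
  `contDiff_rk3Amb` at order 2: `contDiff_rk3AmbDeriv`, `hasDerivAt_rk3AmbDeriv`, `continuous_rk3AmbDeriv2`), and
  the velocity of the flow vector field along the exact flow, `hasDerivAt_vfAmb_wilsonFlow`
  (`d/ds Z̃(V_s) = DZ̃(V_s)·Z̃(V_s)`, `Z̃ = vfAmb`).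
* §2 **`norm_rk3LocalErrDeriv_le`** — there is `M ≥ 0` with `‖rk3LocalErrDeriv s V‖ ≤ M s` for all `s ∈ [0, 1]`
  and ALL configurations `V` (both halves of the derivative of the local error move away from their common value
  at `s = 0` at a bounded speed: compactness of `[0,1] × SU(n)^E` bounds `rk3AmbDeriv2` and `‖DZ̃‖‖Z̃‖`); hence
  **`norm_rk3LocalErr_le_sq`** — `‖RK3_ε V − wilsonFlow ε V‖ ≤ M ε²` for all `ε ∈ [0, 1]` and all `V`: the local
  error is `O(ε²)` UNIFORMLY (consistency of order 2 in the language of `oneStep_dist_iterate_le_of_order`).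
* §3 **`dist_iterate_wilsonFlowRK3_le`** — the GLOBAL error after `k` steps of size `ε ∈ [0, 1]`:
  `dist (RK3_ε^k V) (wilsonFlow (kε) V) ≤ M (kε) e^{K kε} ε` for every `V`; and at fixed flow time,
  **`dist_iterate_wilsonFlowRK3_le_div`** — for every `t ≥ 0` there is `C` with
  `dist (RK3_{t/m}^m V) (wilsonFlow t V) ≤ C / m` for all `m ≥ t` and ALL `V`: first-order convergence, uniformly.

NOT CLAIMED: the constants (existential, from compactness); order three; negative flow times; any number.
-/

namespace Summit.Ventures.LatticeQCDFlow.Scoring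

open Matrix Filter Topology Set Literature.MathematicalPhysics.QuantumFieldTheory
open Literature.MathematicalPhysics.QuantumFieldTheory.Luscher2010 (AmbConfig)
open Summit.Ventures.LatticeQCDFlow.Theory2.Lattice.SUN (dist_coeConfig)

open scoped Matrix.Norms.Frobenius NNReal

-- The scoped Frobenius instances are definitionally the product structures, but only at default transparency
-- (as in Mathlib's `MatrixExponential` and `Scoring/WilsonFlowRK3Consistency`).
set_option backward.isDefEq.respectTransparency false

variable {d L n : ℕ} [NeZero L]

/-! ## §1 Second step-size derivative of the scheme; velocity of the vector field along the flow -/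

section SecondDerivative

/-- The step-size derivative `rk3AmbDeriv` is itself `C^m` jointly in (step size, field), for every `m`. -/
theorem contDiff_rk3AmbDeriv {m : WithTop ℕ∞} :
    ContDiff ℝ m fun p : ℝ × AmbConfig d L n => rk3AmbDeriv p.1 p.2 := by
  have h := (contDiff_rk3Amb (d := d) (L := L) (n := n) (m := m + 1)).fderiv_right le_rfl
  exact h.clm_apply contDiff_const

/-- The SECOND step-size derivative of the ambient scheme, `∂_ε rk3AmbDeriv`. -/
noncomputable def rk3AmbDeriv2 (ε : ℝ) (W : AmbConfig d L n) : AmbConfig d L n :=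
  fderiv ℝ (fun p : ℝ × AmbConfig d L n => rk3AmbDeriv p.1 p.2) (ε, W) (1, 0)

/-- `ε ↦ rk3AmbDeriv ε W` has derivative `rk3AmbDeriv2 ε W` at every `ε`. -/
theorem hasDerivAt_rk3AmbDeriv (ε : ℝ) (W : AmbConfig d L n) :
    HasDerivAt (fun ε : ℝ => rk3AmbDeriv ε W) (rk3AmbDeriv2 ε W) ε := by
  have hF : HasFDerivAt (fun p : ℝ × AmbConfig d L n => rk3AmbDeriv p.1 p.2)
      (fderiv ℝ (fun p : ℝ × AmbConfig d L n => rk3AmbDeriv p.1 p.2) (ε, W)) (ε, W) :=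
    ((contDiff_rk3AmbDeriv (m := 1)).differentiable one_ne_zero (ε, W)).hasFDerivAt
  have hc : HasDerivAt (fun s : ℝ => (s, W)) ((1 : ℝ), (0 : AmbConfig d L n)) ε :=
    (hasDerivAt_id ε).prodMk (hasDerivAt_const ε W)
  exact hF.comp_hasDerivAt ε hc

/-- The second step-size derivative is jointly continuous. -/
theorem continuous_rk3AmbDeriv2 : Continuous fun p : ℝ × AmbConfig d L n => rk3AmbDeriv2 p.1 p.2 := by
  have h := (contDiff_rk3AmbDeriv (d := d) (L := L) (n := n) (m := 1)).continuous_fderiv one_ne_zero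
  exact h.clm_apply continuous_const

/-- **Velocity of the flow vector field along the exact flow**: `s ↦ Z̃(V_s)` (`Z̃ = vfAmb`, `V_s = wilsonFlow s V`
read in the ambient space) has derivative `DZ̃(V_s) · Z̃(V_s)` (chain rule: `Z̃` is `C¹`, `contDiff_vfAmb`, and
`V_s` solves `V̇ = Z̃(V)`). -/
theorem hasDerivAt_vfAmb_wilsonFlow (V : GaugeConfig d L (Matrix.specialUnitaryGroup (Fin n) ℂ)) (s : ℝ) :
    HasDerivAt (fun s : ℝ => WilsonFlow.vfAmb (WilsonFlow.coeConfig (wilsonFlow s V)))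
      (fderiv ℝ WilsonFlow.vfAmb (WilsonFlow.coeConfig (wilsonFlow s V))
        (WilsonFlow.vfAmb (WilsonFlow.coeConfig (wilsonFlow s V)))) s := by
  have hZ : HasFDerivAt (WilsonFlow.vfAmb (d := d) (L := L) (n := n))
      (fderiv ℝ WilsonFlow.vfAmb (WilsonFlow.coeConfig (wilsonFlow s V))) (WilsonFlow.coeConfig (wilsonFlow s V)) :=
    ((WilsonFlow.contDiff_vfAmb (m := 1)).differentiable one_ne_zero _).hasFDerivAt
  exact hZ.comp_hasDerivAt s
    (WilsonFlow.hasDerivAt_coeConfig_of_isWilsonFlowLine (isWilsonFlowLine_wilsonFlow V) s)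

end SecondDerivative

/-! ## §2 The local error is `O(ε²)`, uniformly -/

section LocalRate

/-- A uniform bound for the second step-size derivative of the scheme on `[0, 1] × SU(n)^E` (compactness). -/
theorem exists_bound_rk3AmbDeriv2 :
    ∃ M : ℝ, 0 ≤ M ∧ ∀ s ∈ Icc (0 : ℝ) 1, ∀ V : GaugeConfig d L (Matrix.specialUnitaryGroup (Fin n) ℂ),
      ‖rk3AmbDeriv2 s (WilsonFlow.coeConfig V)‖ ≤ M := by
  have hK : IsCompact ((Icc (0 : ℝ) 1) ×ˢ (univ : Set (GaugeConfig d L (Matrix.specialUnitaryGroup (Fin n) ℂ)))) :=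
    isCompact_Icc.prod isCompact_univ
  have hc : Continuous fun p : ℝ × GaugeConfig d L (Matrix.specialUnitaryGroup (Fin n) ℂ) =>
      rk3AmbDeriv2 p.1 (WilsonFlow.coeConfig p.2) :=
    continuous_rk3AmbDeriv2.comp (continuous_fst.prodMk (WilsonFlow.continuous_coeConfig.comp continuous_snd))
  obtain ⟨M, hM⟩ := hK.exists_bound_of_continuousOn hc.continuousOn
  refine ⟨max M 0, le_max_right _ _, fun s hs V => ?_⟩
  exact (hM (s, V) ⟨hs, mem_univ V⟩).trans (le_max_left _ _)

/-- A uniform bound for the speed of the vector field along the flow, `‖DZ̃(W) Z̃(W)‖ ≤ M` on `SU(n)^E`. -/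
theorem exists_bound_fderiv_vfAmb :
    ∃ M : ℝ, 0 ≤ M ∧ ∀ V : GaugeConfig d L (Matrix.specialUnitaryGroup (Fin n) ℂ),
      ‖fderiv ℝ WilsonFlow.vfAmb (WilsonFlow.coeConfig V) (WilsonFlow.vfAmb (WilsonFlow.coeConfig V))‖ ≤ M := by
  have hc : Continuous fun V : GaugeConfig d L (Matrix.specialUnitaryGroup (Fin n) ℂ) =>
      fderiv ℝ WilsonFlow.vfAmb (WilsonFlow.coeConfig V) (WilsonFlow.vfAmb (WilsonFlow.coeConfig V)) := by
    have h1 : Continuous fun V : GaugeConfig d L (Matrix.specialUnitaryGroup (Fin n) ℂ) =>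
        fderiv ℝ WilsonFlow.vfAmb (WilsonFlow.coeConfig V) :=
      ((WilsonFlow.contDiff_vfAmb (d := d) (L := L) (n := n) (m := 1)).continuous_fderiv one_ne_zero).comp
        WilsonFlow.continuous_coeConfig
    have h2 : Continuous fun V : GaugeConfig d L (Matrix.specialUnitaryGroup (Fin n) ℂ) =>
        WilsonFlow.vfAmb (WilsonFlow.coeConfig V) :=
      (WilsonFlow.contDiff_vfAmb (m := 0)).continuous.comp WilsonFlow.continuous_coeConfig
    exact h1.clm_apply h2
  obtain ⟨M, hM⟩ := (isCompact_univ (X := GaugeConfig d L (Matrix.specialUnitaryGroup (Fin n) ℂ))).exists_bound_of_continuousOn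
    hc.continuousOn
  exact ⟨max M 0, le_max_right _ _, fun V => (hM V (mem_univ V)).trans (le_max_left _ _)⟩

/-- **The derivative of the local error grows at most linearly in the step size, uniformly**: there is `M ≥ 0`
with `‖rk3LocalErrDeriv s V‖ ≤ M s` for all `s ∈ [0, 1]` and every configuration `V`.  (It vanishes at `s = 0`,
`rk3LocalErrDeriv_zero`, and both of its halves have uniformly bounded `s`-derivatives.) -/
theorem norm_rk3LocalErrDeriv_le :
    ∃ M : ℝ, 0 ≤ M ∧ ∀ s ∈ Icc (0 : ℝ) 1, ∀ V : GaugeConfig d L (Matrix.specialUnitaryGroup (Fin n) ℂ),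
      ‖rk3LocalErrDeriv s V‖ ≤ M * s := by
  obtain ⟨MA, hMA0, hMA⟩ := exists_bound_rk3AmbDeriv2 (d := d) (L := L) (n := n)
  obtain ⟨MB, hMB0, hMB⟩ := exists_bound_fderiv_vfAmb (d := d) (L := L) (n := n)
  refine ⟨MA + MB, add_nonneg hMA0 hMB0, fun s hs V => ?_⟩
  -- half A: the scheme's step-size derivative
  have hA : ‖rk3AmbDeriv s (WilsonFlow.coeConfig V) - rk3AmbDeriv 0 (WilsonFlow.coeConfig V)‖ ≤ MA * (s - 0) := by
    refine norm_image_sub_le_of_norm_deriv_le_segment' (f := fun s : ℝ => rk3AmbDeriv s (WilsonFlow.coeConfig V))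
      (fun x _ => (hasDerivAt_rk3AmbDeriv x _).hasDerivWithinAt) (fun x hx => ?_) s ⟨hs.1, le_rfl⟩
    exact hMA x ⟨hx.1, le_trans (le_of_lt hx.2) hs.2⟩ V
  -- half B: the vector field along the exact flow
  have hB : ‖WilsonFlow.vfAmb (WilsonFlow.coeConfig (wilsonFlow s V)) -
      WilsonFlow.vfAmb (WilsonFlow.coeConfig (wilsonFlow 0 V))‖ ≤ MB * (s - 0) := by
    refine norm_image_sub_le_of_norm_deriv_le_segment'
      (f := fun s : ℝ => WilsonFlow.vfAmb (WilsonFlow.coeConfig (wilsonFlow s V)))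
      (fun x _ => (hasDerivAt_vfAmb_wilsonFlow V x).hasDerivWithinAt) (fun x _ => hMB (wilsonFlow x V)) s ⟨hs.1, le_rfl⟩
  -- assemble: the two halves agree at `s = 0`
  have h0 : rk3AmbDeriv 0 (WilsonFlow.coeConfig V) = WilsonFlow.vfAmb (WilsonFlow.coeConfig (wilsonFlow 0 V)) := by
    rw [rk3AmbDeriv_zero_coeConfig, wilsonFlow_zero]
  have hsplit : rk3LocalErrDeriv s V =
      (rk3AmbDeriv s (WilsonFlow.coeConfig V) - rk3AmbDeriv 0 (WilsonFlow.coeConfig V)) -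
        (WilsonFlow.vfAmb (WilsonFlow.coeConfig (wilsonFlow s V)) -
          WilsonFlow.vfAmb (WilsonFlow.coeConfig (wilsonFlow 0 V))) := by
    rw [rk3LocalErrDeriv, h0]
    abel
  rw [hsplit, sub_zero] at *
  calc ‖(rk3AmbDeriv s (WilsonFlow.coeConfig V) - rk3AmbDeriv 0 (WilsonFlow.coeConfig V)) -
        (WilsonFlow.vfAmb (WilsonFlow.coeConfig (wilsonFlow s V)) -
          WilsonFlow.vfAmb (WilsonFlow.coeConfig (wilsonFlow 0 V)))‖
      ≤ ‖rk3AmbDeriv s (WilsonFlow.coeConfig V) - rk3AmbDeriv 0 (WilsonFlow.coeConfig V)‖ +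
        ‖WilsonFlow.vfAmb (WilsonFlow.coeConfig (wilsonFlow s V)) -
          WilsonFlow.vfAmb (WilsonFlow.coeConfig (wilsonFlow 0 V))‖ := norm_sub_le _ _
    _ ≤ MA * s + MB * s := add_le_add hA hB
    _ = (MA + MB) * s := by ring

/-- **The one-step error of the engine's integrator is `O(ε²)`, UNIFORMLY over all configurations**: there is
`M ≥ 0` with `‖coeConfig (RK3_ε V) − coeConfig (wilsonFlow ε V)‖ ≤ M ε²` for all `ε ∈ [0, 1]` and every `V`
(mean value inequality with the linear bound `norm_rk3LocalErrDeriv_le` on `[0, ε]`). -/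
theorem norm_rk3LocalErr_le_sq :
    ∃ M : ℝ, 0 ≤ M ∧ ∀ ε ∈ Icc (0 : ℝ) 1, ∀ V : GaugeConfig d L (Matrix.specialUnitaryGroup (Fin n) ℂ),
      ‖rk3LocalErr ε V‖ ≤ M * ε ^ 2 := by
  obtain ⟨M, hM0, hM⟩ := norm_rk3LocalErrDeriv_le (d := d) (L := L) (n := n)
  refine ⟨M, hM0, fun ε hε V => ?_⟩
  have hderiv : ∀ s ∈ Icc (0 : ℝ) ε,
      HasDerivWithinAt (fun s : ℝ => rk3LocalErr s V) (rk3LocalErrDeriv s V) (Icc 0 ε) s :=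
    fun s _ => (hasDerivAt_rk3LocalErr V s).hasDerivWithinAt
  have hbound : ∀ s ∈ Ico (0 : ℝ) ε, ‖rk3LocalErrDeriv s V‖ ≤ M * ε := by
    intro s hs
    have h := hM s ⟨hs.1, le_trans (le_of_lt hs.2) hε.2⟩ V
    exact h.trans (mul_le_mul_of_nonneg_left (le_of_lt hs.2) hM0)
  have h := norm_image_sub_le_of_norm_deriv_le_segment' hderiv hbound ε ⟨hε.1, le_rfl⟩
  rw [rk3LocalErr_zero, sub_zero, sub_zero] at h
  calc ‖rk3LocalErr ε V‖ ≤ M * ε * ε := h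
    _ = M * ε ^ 2 := by ring

/-- The same in the metric of the configuration space: `dist (RK3_ε V) (wilsonFlow ε V) ≤ M ε²` uniformly. -/
theorem dist_wilsonFlowRK3_wilsonFlow_le_sq :
    ∃ M : ℝ, 0 ≤ M ∧ ∀ ε ∈ Icc (0 : ℝ) 1, ∀ V : GaugeConfig d L (Matrix.specialUnitaryGroup (Fin n) ℂ),
      dist (wilsonFlowRK3 ε V) (wilsonFlow ε V) ≤ M * ε ^ 2 := by
  obtain ⟨M, hM0, hM⟩ := norm_rk3LocalErr_le_sq (d := d) (L := L) (n := n)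
  refine ⟨M, hM0, fun ε hε V => ?_⟩
  rw [← dist_coeConfig, dist_eq_norm]
  exact hM ε hε V

end LocalRate

/-! ## §3 The global error is `O(ε)`: first-order convergence, uniformly -/

section GlobalRate

/-- **Global error bound for the engine's integrator.**  There are `M, K ≥ 0` such that for every step size
`ε ∈ [0, 1]`, every number of steps `k` and EVERY configuration `V`,
`dist (RK3_ε^k V) (wilsonFlow (kε) V) ≤ M · (kε) · e^{K kε} · ε` — local errors `M ε²` accumulated over `k`
steps and amplified by the Grönwall factor of the exact flow (`oneStep_dist_iterate_le_of_order` with `p = 1`). -/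
theorem dist_iterate_wilsonFlowRK3_le :
    ∃ M K : ℝ, 0 ≤ M ∧ 0 ≤ K ∧ ∀ ε ∈ Icc (0 : ℝ) 1, ∀ (k : ℕ) (V : GaugeConfig d L (Matrix.specialUnitaryGroup (Fin n) ℂ)),
      dist ((wilsonFlowRK3 ε)^[k] V) (wilsonFlow (k * ε) V) ≤ M * (k * ε) * Real.exp (K * (k * ε)) * ε := by
  obtain ⟨M, hM0, hM⟩ := dist_wilsonFlowRK3_wilsonFlow_le_sq (d := d) (L := L) (n := n)
  obtain ⟨K, hK⟩ := wilsonFlow_dist_le (d := d) (L := L) (n := n)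
  refine ⟨M, K, hM0, K.coe_nonneg, fun ε hε k V => ?_⟩
  have h := oneStep_dist_iterate_le_of_order (K := univ) (φ := fun s => wilsonFlow s) (Φ := fun ε => wilsonFlowRK3 ε)
    (L := K) (C := M) (p := 1) K.coe_nonneg hε.1 (fun s _ => mapsTo_univ _ _) (mapsTo_univ _ _)
    (fun x _ => by rw [wilsonFlow_zero]) (fun s t _ _ x _ => wilsonFlow_add s t x)
    (fun s hs x _ y _ => hK s hs x y) (fun x _ => by simpa only [pow_succ, pow_one] using hM ε hε x) V (mem_univ V) k
  simpa only [pow_one] using h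

/-- **First-order convergence at fixed flow time, uniformly in the configuration.**  For every `t ≥ 0` there is
a constant `C` such that for every `m ≥ t` (so that the step `t/m ≤ 1`) and EVERY configuration `V`,
`dist (RK3_{t/m}^m V) (wilsonFlow t V) ≤ C / m`. -/
theorem dist_iterate_wilsonFlowRK3_le_div {t : ℝ} (ht : 0 ≤ t) :
    ∃ C : ℝ, 0 ≤ C ∧ ∀ m : ℕ, t ≤ m → ∀ V : GaugeConfig d L (Matrix.specialUnitaryGroup (Fin n) ℂ),
      dist ((wilsonFlowRK3 (t / m))^[m] V) (wilsonFlow t V) ≤ C / m := by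
  obtain ⟨M, K, hM0, hK0, h⟩ := dist_iterate_wilsonFlowRK3_le (d := d) (L := L) (n := n)
  refine ⟨M * t * Real.exp (K * t) * t, by positivity, fun m hm V => ?_⟩
  rcases Nat.eq_zero_or_pos m with h0 | hmpos
  · -- `m = 0` forces `t = 0`; both sides are `V`
    subst h0
    have ht0 : t = 0 := le_antisymm (by simpa using hm) ht
    subst ht0
    simp [wilsonFlow_zero]
  · have hmR : (0 : ℝ) < m := Nat.cast_pos.mpr hmpos
    have hε : t / m ∈ Icc (0 : ℝ) 1 := ⟨div_nonneg ht hmR.le, (div_le_one hmR).mpr hm⟩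
    have hmt : (m : ℝ) * (t / m) = t := mul_div_cancel₀ t (ne_of_gt hmR)
    have hb := h (t / m) hε m V
    rw [hmt] at hb
    calc dist ((wilsonFlowRK3 (t / m))^[m] V) (wilsonFlow t V) ≤ M * t * Real.exp (K * t) * (t / m) := hb
      _ = M * t * Real.exp (K * t) * t / m := by ring

end GlobalRate

end Summit.Ventures.LatticeQCDFlow.Scoring
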